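import Literature.MathematicalPhysics.QuantumFieldTheory.Balaban1983to89.B9Cor36GDirKnitRowsAtMemberY
import Literature.MathematicalPhysics.QuantumFieldTheory.Balaban1983to89.B9BackgroundsKLevelV1R
import Literature.MathematicalPhysics.QuantumFieldTheory.Balaban1983to89.B9CubeDataHermitianPart

/-!
# `Balaban1983to89.B9Cor36GDirBondDatumOfReg335Cube` — [Balaban1985BackgroundPropagators] Cor. 3.6 p. 408 l. 1–14 («Ω₀(□) ⊂ □⁵ … the cube □⁵ is contained in one
# of the cubes for which this condition holds»): THE (3.35) BOND DATUM `DatumBUY i □ U a₁ α₀′ ϱ′` OF THE DIRICHLET BOND LETTER OF RECORD (F6, the heads' displayed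
# `hDatBu`) FROM ONE (3.35) CUBE DATUM `Reg335Cube (shiftsV1 _) U η □̃ ξ C` (✓`B9Eq335RegularityClasses`, the per-cube currency of the heads' regime
# `Reg335BodyP` over print's class `cubeClassP`) ON ANY SITE SET `□̃ ⊇ chart⁻¹(bondCutSetY i □)` — the ANALYTIC half of the datum supply; the GEOMETRIC half
# (an aligned class cube of index `j′ ∈ {j−1, j}` containing the cut set: LOCATED-39∕40) is the next file — plus the C⋆-lemma «`‖u‖ ≤ 1 ∧ ‖u⁻¹‖ ≤ 1 ⇒ u`
# unitary» (✓`B9CubeDataHermitianPart.mem_unitaryUnits_of_bicontractive`, this lineage g32) turning the regime's bi-contractive gauge into F6's unitary one (seat dag-n06-c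
# g36, FILE D1 of the datum road of director-ym №687∕№688, re-keyed to print's class by this seat's CORRECTION)

statement-level skeleton of published theorems with citation tags; proofs where landed; nothing here is a claim about the Yang–Mills mass gap

CITATION HEADER (lean-in-tree rule).  B9 = T. Bałaban, *Propagators for lattice gauge theories in a background field*, Commun. Math. Phys. **99** (1985)
389–434 [Balaban1985BackgroundPropagators] (held `paper:balaban1985-cmp99-background-propagators`; journal page = PDF page + 388): (3.35) p. 396 («there exists a
gauge transformation u on □ such that U^u = e^{iηA} and |A| < O(1)Mα₀(Lʲη)⁻¹, |∇^η A| < O(1)Mα₀(Lʲη)⁻² on □», «□ is a union of several big blocks … its size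
in the lattice T_η is O(1)MLʲη»); Cor. 3.6 p. 408 l. 1–14 («This follows from Corollary 3.5 applied to the configuration U′ = Uᵘ … Ω₀(□) ⊂ □⁵ … the number O(1)
in the condition (3.35) can be taken as equal to 12, thus the cube □⁵ is contained in one of the cubes for which this condition holds»); (3.28) p. 395 (`Uᵘ`);
p. 390 («U with values in G»).  T. Bałaban, *Averaging operations for lattice gauge theories*, Commun. Math. Phys. **98** (1985) 17–51 [Balaban1985Averaging]
(19) p. 21 (the operator norm; `U(N) ⊂ {|u| ≤ 1, |u⁻¹| ≤ 1}`).  Rows B9.Cor3.6 × B9.Eq3.35 (cells only; no row head changes).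

WHY THIS FILE (cell `pub-ymgap`, node N06 [B9]; road (B5)).  After «E2 BY NAME» (R1–R5) the heads («KE₂₁X-C» ∕ «KE₂₂X») display for the Dirichlet bond letter of record
the (3.35) bond datum `hDatBu : … → ∀ □, DatumBUY x.toKIdx □ U gdirRa₁ α₀K ϱ′` under the regime antecedent `U ∈ R₁ ⊇ regYP335` = ✓`Reg335BodyP` = «U is
G-valued» ∧ `Reg335Cube (shiftsV1 _) U η □̃ (L^{j′}η) (n·M·α₀)` on every cube `(□̃, j′, n)` of print's class ✓`cubeClassP` (aligned, `n ≥ c` big `j′`-blocks, ANY size,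
level clause; per-cube constant `n·M·α₀`, size-linear — this seat's CORRECTION to LOCATED-39 §1).  `DatumBWit i □ U …` (F6 :96) IS `Reg335Cube`'s four rows read on
a box `Q ⊇ chart⁻¹T`, `T ⊇ Ω₀(□)` + one plaquette layer (dag-n06-d's canonical ✓`bondCutSetY i □`), with `≤` for `<`, a UNITARY gauge (F6 asks `∀ z, u z ∈ U(N)`;
the regime gives `‖u‖, ‖u⁻¹‖ ≤ 1` on `□̃` only), the scale rows `η ≤ ξ`, `1 ≤ Λ`, `L^{j+1}η ≤ Λξ`, and the knit-engine numerics on `2CΛ²`.  THIS FILE: §1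
`gaugeY_eq_gaugeTr` (def-Y's `Uᵍ` IS lit's (3.28) `gaugeTr` at the torus shifts, `rfl`), the unitary extension `unitExtY` of a bi-contractive gauge by `1` off `□̃`
(unitary everywhere by ✓`mem_unitaryUnits_of_bicontractive`); §2 ★★★`datumBWit_of_reg335Cube` ∕ `datumBUY_of_reg335Cube`: a (3.35) cube datum on `□̃ ⊇ chart⁻¹(bondCutSetY i □)` at scale `ξ ≥ η` with constant `C`, a
`Λ ≥ 1` with `L^{j+1}η ≤ Λξ`, and the numerics on `2CΛ²` ⟹ `DatumBUY i □ U a₁ α₀′ ϱ′` (with `T := bondCutSetY i □`, `Q := □̃`); §3 ★★★`datumBUY_of_reg335BodyP` ∕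
★★★`datumBUY_of_regYP335`: the same from the heads' regime `(bg9KP 𝔸 G i).Reg335 c_P α₀ U` ∕ `regYP335 … x c_P α₀ U` (✓`reg335CubeP_of_reg335P` + ✓`alignedCube_mem_cubeClassP`,
director-ym №689), GIVEN THE INSCRIPTION — an aligned cube `torusCube c₀ (n·S_{j′})`, `1 ≤ j′ ≤ k`, `n ≥ max(1, c_P)`, level clause, containing `chart⁻¹(bondCutSetY i □)` —
with `ξ = L^{j′}η`, `C = n·M·α₀`, any `Λ ≥ 1` with `L^{j+1}η ≤ Λ·L^{j′}η` (the inscription is the GEOMETRIC display; LOCATED-39: `j′ ∈ {j−1, j}`, `n ≈ 2R + 4L + …`; next file).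

WHAT IS PROVED (1 `def` with body — `unitExtY`; theorems; 0 sorry; 0 `def … : Prop`; 0 new named facts; standard axioms): §1 `gaugeY_eq_gaugeTr`, `unitExtY`,
`unitExtY_of_mem`, `unitExtY_mem_unitaryUnits`, `gaugeY_unitExtY_eq`; §2 ★★★`datumBWit_of_reg335Cube`, ★★★`datumBUY_of_reg335Cube`; §3 `kGeo_L_eq`, ★★★`datumBUY_of_reg335BodyP`,
★★★`datumBUY_of_regYP335`.

HONEST SCOPE ∕ NOT CLAIMED.  A dictionary between two landed predicates; NO estimate and NO geometry: the inscription of the cut set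
into a class cube (LOCATED-39 (a)∕(b): index `j′ ∈ {j−1, j}`, ≈ `2R + 4L + …` blocks, member ring margin) and the wrap case (LOCATED-40) are NOT here; the numerics on
`2CΛ²` are DISPLAYED (the heads' regime smallness supplies them).  Nothing on `d = 4`, the continuum, reflection positivity or the mass gap; NOT a node discharge;
count-neutral; no row head changes.  NEW file; nothing landed is modified.  `--supports stmt-QuantumFields-27239`.

RELATED IN THE TREE, NOT DUPLICATED (searched 2026-09-01: `rg 'datumBWit_of_reg335|datumBUY_of_reg335|datumBUY_of_regYP335|gaugeY_eq_gaugeTr|unitExtY'` over `Literature/` + `Summits/` = ∅; the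
unitarity lemma is ✓`B9CubeDataHermitianPart.mem_unitaryUnits_of_bicontractive`, USED, not restated): F6 ✓`B9Cor36GDirKnitRowsAtMemberY` (`DatumBWit`,
`DatumBUY`), dag-n06-d ✓`B9CubeDirInverseBondCMemberRowsAtRecordY` §5 (`bondCutSetY`, `hT_bondCutSetY`, `dirDomY_subset_bondCutSetY`, `DatumBondUY`), def-Y
✓`B9BackgroundsKLevelV1P` (`Reg335BodyP`, `cubeClassP`), r06 ✓`B9Eq335RegularityClasses` (`Reg335Cube`), ✓`B7Prop2Explicit` (`unitaryUnits`, `unitaryUnits_le_U1`).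
-/

noncomputable section

namespace Literature.MathematicalPhysics.QuantumFieldTheory.Balaban1983to89.B9Cor36GDirBondDatumOfReg335Cube

open B6KLevelCensusIndexV1 (KIdx kGeo)
open B6Cover236MultiLevelBlocks (cubes)
open B6GlobalChartV1 (PV boxEquiv)
open B9Eq39Adjoint (fluct covD)
open B9BackgroundsKLevelV1 (shiftsV1 torusCube levV1)
open B6MultiLevelBoxOperator (bigSide)
open B9BackgroundsKLevelV1P (bg9KP cubeClassP alignedCube_mem_cubeClassP reg335CubeP_of_reg335P)
open B9BackgroundsKLevelV1R (regYP335)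
open B9PinMembersKLevelV1 (MemberY)
open B9Eq3117Current (gaugeTr)
open B9Eq335RegularityClasses (Reg335Cube)
open B9Eq360DeltaPrimeAY (AfldY)
open B9CubeLettersOpsL0 (levCubeY)
open B9Cor35GpDirInputsAtOne (dirDomY)
open B9Cor36GDirKnitRowsAtMemberY (DatumBWit DatumBUY)
open B9CubeDirInverseBondCMemberRowsAtRecordY (bondCutSetY hT_bondCutSetY dirDomY_subset_bondCutSetY)
open B9BondReadDomainsPinY (nearAPinCY)
open B7Prop2Explicit (unitaryUnits)
open B9CubeDataHermitianPart (mem_unitaryUnits_of_bicontractive)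
open Node00 (SiteY CfgY GaugeY toKT shiftY gaugeY)
open scoped Matrix Matrix.Norms.L2Operator

variable {d ℓ : ℕ} {hd : 1 ≤ d + 1} {hL : Odd (ℓ + 1) ∧ 1 < ℓ + 1} {b₀ b₁ : ℝ} {N : ℕ}

/-! ## §1  def-Y's gauge action IS (3.28) at the torus shifts; the unitary extension of a bi-contractive gauge (unitary by dag-n06-c g32's ✓`mem_unitaryUnits_of_bicontractive`) -/

section Gauge

variable (i : KIdx d ℓ hd hL b₀ b₁)

/-- `gaugeY i u U κ x = gaugeTr (shiftsV1 _) u U κ x` (`u(x)·U(x, x+e_κ)·u(x+e_κ)⁻¹` on both sides; `rfl`). [cite: Balaban1985BackgroundPropagators, (3.28) p.395, bookkeeping] -/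
theorem gaugeY_eq_gaugeTr (u : GaugeY (Matrix (Fin N) (Fin N) ℂ) i) (U : CfgY (Matrix (Fin N) (Fin N) ℂ) i) (κ : Fin (d + 1))
    (x : Site (PV d ℓ i.m i.K hd hL) 0) : gaugeY i u U κ x = gaugeTr (shiftsV1 (PV d ℓ i.m i.K hd hL)) u U κ x := rfl

/-- **the unitary extension of a gauge given on a site set**: `u` on `S`, `1` elsewhere. [cite: Balaban1985BackgroundPropagators, (3.35) p.396 («a gauge transformation u on □»), bookkeeping] -/
def unitExtY (S : Set (Site (PV d ℓ i.m i.K hd hL) 0)) (u : GaugeY (Matrix (Fin N) (Fin N) ℂ) i) : GaugeY (Matrix (Fin N) (Fin N) ℂ) i :=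
  fun z => by classical exact if z ∈ S then u z else 1

/-- on `S` the extension is `u`. [cite: Balaban1985BackgroundPropagators, (3.35) p.396, bookkeeping] -/
theorem unitExtY_of_mem {S : Set (Site (PV d ℓ i.m i.K hd hL) 0)} (u : GaugeY (Matrix (Fin N) (Fin N) ℂ) i) {z : Site (PV d ℓ i.m i.K hd hL) 0} (hz : z ∈ S) :
    unitExtY i S u z = u z := by
  unfold unitExtY; rw [if_pos hz]

/-- the extension is unitary EVERYWHERE once `u` is bi-contractive on `S` (§1). [cite: Balaban1985BackgroundPropagators, (3.35) p.396, p.390 («values in G»); Balaban1985Averaging, (19) p.21] -/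
theorem unitExtY_mem_unitaryUnits {S : Set (Site (PV d ℓ i.m i.K hd hL) 0)} {u : GaugeY (Matrix (Fin N) (Fin N) ℂ) i}
    (hu : ∀ z ∈ S, ‖(u z : Matrix (Fin N) (Fin N) ℂ)‖ ≤ 1 ∧ ‖(((u z)⁻¹ : (Matrix (Fin N) (Fin N) ℂ)ˣ) : Matrix (Fin N) (Fin N) ℂ)‖ ≤ 1) :
    ∀ z, unitExtY i S u z ∈ unitaryUnits (Matrix (Fin N) (Fin N) ℂ) := by
  intro z
  unfold unitExtY
  split_ifs with hz
  · exact mem_unitaryUnits_of_bicontractive (u z) (hu z hz).1 (hu z hz).2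
  · exact (unitaryUnits (Matrix (Fin N) (Fin N) ℂ)).one_mem

/-- on bonds with both ends in `S` the extension acts as `u`. [cite: Balaban1985BackgroundPropagators, (3.28) p.395, bookkeeping] -/
theorem gaugeY_unitExtY_eq {S : Set (Site (PV d ℓ i.m i.K hd hL) 0)} (u : GaugeY (Matrix (Fin N) (Fin N) ℂ) i) (U : CfgY (Matrix (Fin N) (Fin N) ℂ) i)
    (κ : Fin (d + 1)) {x : Site (PV d ℓ i.m i.K hd hL) 0} (hx : x ∈ S) (hx' : x.shift κ ∈ S) :
    gaugeY i (unitExtY i S u) U κ x = gaugeY i u U κ x := by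
  show unitExtY i S u x * U κ x * (unitExtY i S u (x.shift κ))⁻¹ = u x * U κ x * (u (x.shift κ))⁻¹
  rw [unitExtY_of_mem i u hx, unitExtY_of_mem i u hx']

end Gauge

/-! ## §2  ★★★ The (3.35) bond datum of `Ω₀(□)` from ONE (3.35) cube datum on a set containing the cut set -/

section Datum

variable (i : KIdx d ℓ hd hL b₀ b₁) (c : ↥(cubes (toKT i).D.toDomains)) (U : CfgY (Matrix (Fin N) (Fin N) ℂ) i)

/-- ★★★ **`DatumBWit` FROM A (3.35) CUBE DATUM**: if `U` carries a (3.35) datum `Reg335Cube (shiftsV1 _) U η □̃ ξ C` (gauge `u`, potential `A`) on a site set `□̃`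
containing the chart preimage of dag-n06-d's canonical cut set `bondCutSetY i □` (⊇ `Ω₀(□)` and the one-layer thickening of the pinned reading set), at a scale
`ξ ≥ η` with `L^{j+1}η ≤ Λξ`, `Λ ≥ 1`, `C ≥ 0`, and the knit-engine numerics hold for `2CΛ²`, then `DatumBWit i □ U a₁ α₀′ ϱ′ (unitExtY □̃ u) A □̃ (bondCutSetY i □) C ξ Λ`
— the gauge made unitary off∕on `□̃` (§1), (3.35)'s strict rows weakened to `≤`.
[cite: Balaban1985BackgroundPropagators, (3.35) p.396, Cor. 3.6 p.408 l.1–14 («Ω₀(□) ⊂ □⁵ … contained in one of the cubes for which this condition holds»), (3.28) p.395, p.410 l.14–15] -/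
theorem datumBWit_of_reg335Cube {cube : Set (Site (PV d ℓ i.m i.K hd hL) 0)} {ξ C Λ : ℝ} {a₁ α₀' ϱ' : ℝ}
    {u : GaugeY (Matrix (Fin N) (Fin N) ℂ) i} {A : AfldY (Matrix (Fin N) (Fin N) ℂ) i}
    (hu : ∀ z ∈ cube, ‖(u z : Matrix (Fin N) (Fin N) ℂ)‖ ≤ 1 ∧ ‖(((u z)⁻¹ : (Matrix (Fin N) (Fin N) ℂ)ˣ) : Matrix (Fin N) (Fin N) ℂ)‖ ≤ 1)
    (hg : ∀ κ, ∀ z ∈ cube, gaugeTr (shiftsV1 (PV d ℓ i.m i.K hd hL)) u U κ z = fluct (kGeo i).eta A κ z)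
    (hA : ∀ κ, ∀ z ∈ cube, ‖A κ z‖ < C * ξ⁻¹)
    (hdA : ∀ κ ν, ∀ z ∈ cube, ‖(((kGeo i).eta : ℂ)⁻¹) • covD (shiftsV1 (PV d ℓ i.m i.K hd hL)) (fun _ _ => (1 : (Matrix (Fin N) (Fin N) ℂ)ˣ)) κ (A ν) z‖ < C * (ξ ^ 2)⁻¹)
    (hC : 0 ≤ C) (hξ : (kGeo i).eta ≤ ξ) (hΛ : 1 ≤ Λ) (hΛξ : LatticeNorms.scaleLen ((ℓ : ℝ) + 1) (kGeo i).eta (c.1.1 + 1) ≤ Λ * ξ)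
    (hbox : ∀ z ∈ bondCutSetY i c, (boxEquiv i.hN).symm z ∈ cube)
    (hs₁ : 2 * C * Λ ^ 2 ≤ a₁) (hs₂ : 3 * (2 * C * Λ ^ 2) ≤ ϱ')
    (hs₃ : Real.exp (4 * (800 * (((d + 1 : ℕ) : ℝ) + 1) ^ 2 * (((d + 1 : ℕ) : ℝ) + 4)) * α₀') * (1 + 8 * (131072 * (((d + 1 : ℕ) : ℝ) + 1) ^ 2) * (2 * C * Λ ^ 2)) ≤ 2)
    (hs₄ : 2 * (2 * C * Λ ^ 2) ≤ B7Prop3Flat.c3 (d + 1) (ℓ + 1)) (hs₅ : 4096 * ((d + 1 : ℕ) : ℝ) * (2 * C * Λ ^ 2) ≤ 1) :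
    DatumBWit i c U a₁ α₀' ϱ' (unitExtY i cube u) A cube (bondCutSetY i c) C ξ Λ := by
  refine ⟨unitExtY_mem_unitaryUnits i hu, hC, hξ, hΛ, hΛξ, fun z hz => dirDomY_subset_bondCutSetY i c hz, hT_bondCutSetY i c, hbox, ?_,
    fun κ x hx => (hA κ x hx).le, fun μ ν x hx => (hdA μ ν x hx).le, hs₁, hs₂, hs₃, hs₄, hs₅⟩
  intro κ x hx hx'
  rw [gaugeY_unitExtY_eq i u U κ hx hx', gaugeY_eq_gaugeTr]
  exact hg κ x hx

/-- ★★★ **THE (3.35) BOND DATUM OF `Ω₀(□)` FROM ONE (3.35) CUBE DATUM** (Cor. 3.6's «Ω₀(□) ⊂ □⁵ ⊂ □̃»): `Reg335Cube (shiftsV1 _) U η □̃ ξ C` on a set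
`□̃ ⊇ chart⁻¹(bondCutSetY i □)` with the scale rows and the numerics on `2CΛ²` ⟹ `DatumBUY i □ U a₁ α₀′ ϱ′`.  For the heads' regime ✓`Reg335BodyP` (print's class
`cubeClassP`): `□̃` an aligned cube of `n` big `j′`-blocks, `ξ = L^{j′}η`, `C = n·M·α₀`, `Λ = L^{j+1−j′}` (`j′ ∈ {j−1, j}`, next file).
[cite: Balaban1985BackgroundPropagators, (3.35) p.396, Cor. 3.6 p.408 l.1–14, p.409 l.1–5] -/
theorem datumBUY_of_reg335Cube {cube : Set (Site (PV d ℓ i.m i.K hd hL) 0)} {ξ C Λ : ℝ} {a₁ α₀' ϱ' : ℝ}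
    (h335 : Reg335Cube (shiftsV1 (PV d ℓ i.m i.K hd hL)) U (kGeo i).eta cube ξ C)
    (hC : 0 ≤ C) (hξ : (kGeo i).eta ≤ ξ) (hΛ : 1 ≤ Λ) (hΛξ : LatticeNorms.scaleLen ((ℓ : ℝ) + 1) (kGeo i).eta (c.1.1 + 1) ≤ Λ * ξ)
    (hbox : ∀ z ∈ bondCutSetY i c, (boxEquiv i.hN).symm z ∈ cube)
    (hs₁ : 2 * C * Λ ^ 2 ≤ a₁) (hs₂ : 3 * (2 * C * Λ ^ 2) ≤ ϱ')
    (hs₃ : Real.exp (4 * (800 * (((d + 1 : ℕ) : ℝ) + 1) ^ 2 * (((d + 1 : ℕ) : ℝ) + 4)) * α₀') * (1 + 8 * (131072 * (((d + 1 : ℕ) : ℝ) + 1) ^ 2) * (2 * C * Λ ^ 2)) ≤ 2)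
    (hs₄ : 2 * (2 * C * Λ ^ 2) ≤ B7Prop3Flat.c3 (d + 1) (ℓ + 1)) (hs₅ : 4096 * ((d + 1 : ℕ) : ℝ) * (2 * C * Λ ^ 2) ≤ 1) :
    DatumBUY i c U a₁ α₀' ϱ' := by
  obtain ⟨u, A, hu, hg, hA, hdA⟩ := h335
  exact ⟨unitExtY i cube u, A, cube, bondCutSetY i c, C, ξ, Λ,
    datumBWit_of_reg335Cube i c U hu hg hA hdA hC hξ hΛ hΛξ hbox hs₁ hs₂ hs₃ hs₄ hs₅⟩

end Datum


/-! ## §3  ★★★ … from the heads' regime: [4]∕[B9]'s (3.35) class in def-Y's PRINT reading `Reg335BodyP` over `cubeClassP` (any cube size, per-cube constant `n·M·α₀`), the inscription displayed -/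

section RegimeP

variable (i : KIdx d ℓ hd hL b₀ b₁) (c : ↥(cubes (toKT i).D.toDomains)) (U : CfgY (Matrix (Fin N) (Fin N) ℂ) i)

/-- `η ≤ L^{j′}η` and `L^{j+1}η`'s factorisation are bookkeeping; here: `(kGeo i).L = L`, as a real. [cite: Balaban1984PropagatorsII, (2.1) p.224, bookkeeping] -/
theorem kGeo_L_eq : (kGeo i).L = (ℓ : ℝ) + 1 := by
  show (((ℓ + 1 : ℕ) : ℝ)) = (ℓ : ℝ) + 1
  push_cast; ring

/-- ★★★ **THE (3.35) BOND DATUM OF `Ω₀(□)` FROM THE REGIME OF RECORD, GIVEN THE INSCRIPTION** (Cor. 3.6 «Ω₀(□) ⊂ □⁵ ⊂ □̃, □̃ a cube of the class»): if `U` is in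
def-Y's print-class (3.35) regime `(bg9KP 𝔸 G i).Reg335 c_P α₀ U` (= ✓`Reg335BodyP`: (3.35) on EVERY aligned cube of `n ≥ c_P` big `j′`-blocks meeting the level
clause, with constant `n·M·α₀`), and an aligned cube `□̃ = torusCube c₀ (n·S_{j′})` of index `1 ≤ j′ ≤ k`, `j′ ≤ j + 1`, size `n ≥ max(1, c_P)`, all of whose sites
have member level `j′` or `j′ + 1` and one of level `j′` (print p. 396), CONTAINS `chart⁻¹(bondCutSetY i □)`, then — with `ξ = L^{j′}η`, any `Λ ≥ 1` with
`L^{j+1}η ≤ Λ·L^{j′}η` and the knit numerics on `2·(n·M·α₀)·Λ²` — `DatumBUY i □ U a₁ α₀′ ϱ′`.  The inscription (`c₀, j′, n` + the three clauses) is the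
GEOMETRIC display (LOCATED-39: `j′ ∈ {j−1, j}`, `n ≈ 2R + 4L + …`; next file), the wrap case the heads' member-size row (director-ym №690 (V1)).
[cite: Balaban1985BackgroundPropagators, (3.35) p.396, p.396 (the cube class), Cor. 3.6 p.408 l.1–14, p.409 l.1–5] -/
theorem datumBUY_of_reg335BodyP {G : Subgroup (Matrix (Fin N) (Fin N) ℂ)ˣ} {cP α₀ : ℝ} {a₁ α₀' ϱ' : ℝ}
    (h : (bg9KP (Matrix (Fin N) (Fin N) ℂ) G i).Reg335 cP α₀ U)
    {j' n : ℕ} (c₀ : Site (PV d ℓ i.m i.K hd hL) 0) (hj1 : 1 ≤ j') (hjk : j' ≤ i.k) (hn : 1 ≤ n) (hcn : cP ≤ (n : ℝ))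
    (hc₀ : ∀ μ, bigSide ℓ i.Mh j' ∣ (c₀ μ).val)
    (hlev : ∀ x ∈ torusCube c₀ (n * bigSide ℓ i.Mh j'), levV1 i x = j' ∨ levV1 i x = j' + 1)
    (hmeet : ∃ x ∈ torusCube c₀ (n * bigSide ℓ i.Mh j'), levV1 i x = j')
    (hbox : ∀ z ∈ bondCutSetY i c, (boxEquiv i.hN).symm z ∈ torusCube c₀ (n * bigSide ℓ i.Mh j'))
    (hα₀ : 0 ≤ α₀) {Λ : ℝ} (hΛ : 1 ≤ Λ)
    (hΛξ : LatticeNorms.scaleLen ((ℓ : ℝ) + 1) (kGeo i).eta (c.1.1 + 1) ≤ Λ * LatticeNorms.scaleLen ((ℓ : ℝ) + 1) (kGeo i).eta j')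
    (hs₁ : 2 * ((n : ℝ) * ((kGeo i).M * α₀)) * Λ ^ 2 ≤ a₁) (hs₂ : 3 * (2 * ((n : ℝ) * ((kGeo i).M * α₀)) * Λ ^ 2) ≤ ϱ')
    (hs₃ : Real.exp (4 * (800 * (((d + 1 : ℕ) : ℝ) + 1) ^ 2 * (((d + 1 : ℕ) : ℝ) + 4)) * α₀') *
      (1 + 8 * (131072 * (((d + 1 : ℕ) : ℝ) + 1) ^ 2) * (2 * ((n : ℝ) * ((kGeo i).M * α₀)) * Λ ^ 2)) ≤ 2)
    (hs₄ : 2 * (2 * ((n : ℝ) * ((kGeo i).M * α₀)) * Λ ^ 2) ≤ B7Prop3Flat.c3 (d + 1) (ℓ + 1))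
    (hs₅ : 4096 * ((d + 1 : ℕ) : ℝ) * (2 * ((n : ℝ) * ((kGeo i).M * α₀)) * Λ ^ 2) ≤ 1) :
    DatumBUY i c U a₁ α₀' ϱ' := by
  have hq := alignedCube_mem_cubeClassP i hj1 hjk hn hcn c₀ hc₀ hlev hmeet
  have h335 := reg335CubeP_of_reg335P i h hq
  rw [kGeo_L_eq] at h335
  have hη : 0 < (kGeo i).eta := by rw [← B9CubeGeometryInputs.geoCK_eta i c]; exact B9CubeGeometryInputs.geoCK_eta_pos i c
  have hL1 : (1 : ℝ) ≤ (ℓ : ℝ) + 1 := by linarith [(Nat.cast_nonneg ℓ : (0 : ℝ) ≤ ℓ)]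
  have hM : 0 ≤ (kGeo i).M := by
    rw [show (kGeo i).M = ((ℓ + 1 : ℕ) : ℝ) * (i.Mh : ℝ) from rfl]; positivity
  have hC : 0 ≤ (n : ℝ) * ((kGeo i).M * α₀) := by positivity
  have hξ : (kGeo i).eta ≤ LatticeNorms.scaleLen ((ℓ : ℝ) + 1) (kGeo i).eta j' := by
    unfold LatticeNorms.scaleLen
    calc (kGeo i).eta = 1 * (kGeo i).eta := (one_mul _).symm
      _ ≤ ((ℓ : ℝ) + 1) ^ j' * (kGeo i).eta := mul_le_mul_of_nonneg_right (one_le_pow₀ hL1) hη.le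
  exact datumBUY_of_reg335Cube i c U h335 hC hξ hΛ hΛξ hbox hs₁ hs₂ hs₃ hs₄ hs₅

/-- ★★★ **THE SAME AT A MEMBER OF THE RECORD, FROM THE HEADS' CLASS `regYP335`** (✓`B9BackgroundsKLevelV1R`: print's class at the member's index pin AND its second
pin; we use the first): the regime antecedent of «KE₂₁X-C»'s `hDatBu` (through `hRP1`) yields `DatumBUY` at every cover cube admitting the inscription.
[cite: Balaban1985BackgroundPropagators, (3.35) p.396, Cor. 3.6 p.408 l.1–14, p.409 l.1–5] -/
theorem datumBUY_of_regYP335 {Mstar : ℕ} {G : Subgroup (Matrix (Fin N) (Fin N) ℂ)ˣ} (x : MemberY d ℓ hd hL b₀ b₁ Mstar) {cP α₀ : ℝ} {a₁ α₀' ϱ' : ℝ}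
    (U : CfgY (Matrix (Fin N) (Fin N) ℂ) x.toKIdx) (h : regYP335 (Matrix (Fin N) (Fin N) ℂ) G x cP α₀ U) (c : ↥(cubes (toKT x.toKIdx).D.toDomains))
    {j' n : ℕ} (c₀ : Site (PV d ℓ x.m x.K hd hL) 0) (hj1 : 1 ≤ j') (hjk : j' ≤ x.k) (hn : 1 ≤ n) (hcn : cP ≤ (n : ℝ))
    (hc₀ : ∀ μ, bigSide ℓ x.Mh j' ∣ (c₀ μ).val)
    (hlev : ∀ y ∈ torusCube c₀ (n * bigSide ℓ x.Mh j'), levV1 x.toKIdx y = j' ∨ levV1 x.toKIdx y = j' + 1)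
    (hmeet : ∃ y ∈ torusCube c₀ (n * bigSide ℓ x.Mh j'), levV1 x.toKIdx y = j')
    (hbox : ∀ z ∈ bondCutSetY x.toKIdx c, (boxEquiv x.hN).symm z ∈ torusCube c₀ (n * bigSide ℓ x.Mh j'))
    (hα₀ : 0 ≤ α₀) {Λ : ℝ} (hΛ : 1 ≤ Λ)
    (hΛξ : LatticeNorms.scaleLen ((ℓ : ℝ) + 1) (kGeo x.toKIdx).eta (c.1.1 + 1) ≤ Λ * LatticeNorms.scaleLen ((ℓ : ℝ) + 1) (kGeo x.toKIdx).eta j')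
    (hs₁ : 2 * ((n : ℝ) * ((kGeo x.toKIdx).M * α₀)) * Λ ^ 2 ≤ a₁) (hs₂ : 3 * (2 * ((n : ℝ) * ((kGeo x.toKIdx).M * α₀)) * Λ ^ 2) ≤ ϱ')
    (hs₃ : Real.exp (4 * (800 * (((d + 1 : ℕ) : ℝ) + 1) ^ 2 * (((d + 1 : ℕ) : ℝ) + 4)) * α₀') *
      (1 + 8 * (131072 * (((d + 1 : ℕ) : ℝ) + 1) ^ 2) * (2 * ((n : ℝ) * ((kGeo x.toKIdx).M * α₀)) * Λ ^ 2)) ≤ 2)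
    (hs₄ : 2 * (2 * ((n : ℝ) * ((kGeo x.toKIdx).M * α₀)) * Λ ^ 2) ≤ B7Prop3Flat.c3 (d + 1) (ℓ + 1))
    (hs₅ : 4096 * ((d + 1 : ℕ) : ℝ) * (2 * ((n : ℝ) * ((kGeo x.toKIdx).M * α₀)) * Λ ^ 2) ≤ 1) :
    DatumBUY x.toKIdx c U a₁ α₀' ϱ' :=
  datumBUY_of_reg335BodyP x.toKIdx c U h.1 c₀ hj1 hjk hn hcn hc₀ hlev hmeet hbox hα₀ hΛ hΛξ hs₁ hs₂ hs₃ hs₄ hs₅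

end RegimeP

end Literature.MathematicalPhysics.QuantumFieldTheory.Balaban1983to89.B9Cor36GDirBondDatumOfReg335Cube

end
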